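import Summits.Ventures.PercRepro.Night2SevenFiveResidues
import Summits.Ventures.PercRepro.Night2LocalD3ZeroClosure

/-!
# PercRepro — the FACE SUM of a covering basis (night-2, gen 20)

A covering set `Q` of a hyperplane-basis member (`K ⊆ Q`, `|Q ∖ K| = ρ`, `cl Q = G`) is a basis of `G`; its
FACES are the hyperplanes `cl (Q ∖ w)`, `w ∈ Q ∖ K`, and `m_w := |G ∖ cl (Q ∖ w)|` is the number of points of `G`
the face misses (the request of the thin member `Q ∖ w` is `Φ/(m_w + d)`).  For every point `y ∈ G ∖ Q` the set
`{w : y ∉ cl (Q ∖ w)}` is the `Q`-support of `y` (the trace of its fundamental circuit), which has at least two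
elements in a simple loopless matroid (`two_le_card_support`: a point in the closures of all but at most one
element of `Q ∖ K` would be parallel to that element or in `cl K`), and `w` itself is missed by its own face.  Hence

* **`two_mul_card_le_sum_faces`**: `Σ_{w ∈ Q ∖ K} m_w ≥ 2 |G ∖ K| − ρ`;
* `two_le_card_face`: `m_w ≥ 2` (`w` is not a coloop of `M|G`), `card_face_le`: `m_w ≤ |G ∖ K| − ρ + 1`.

This is the structural input of the PER-BASIS loss bound of `Night2ExcessLoss`: the faces of a saturated basis
cannot all be fat.
-/

namespace PercRepro.Shadow

open Finset PerFlat ThmH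

variable {α : Type*} [DecidableEq α] {M : Matroid α} [M.Finite]

/-- A shadow set `Q` with `|Q ∖ K| = ρ` (`kColoops + ρ = q + 1`) is independent: `|Q| = q + 1 = ρ(Q)`. -/
theorem indep_of_mem_shadowAt_card {q ρ : ℕ} {G : Finset α}
    (hk : kColoops M G + ρ = q + 1) {Q : Finset α} (hQ : Q ∈ shadowAt M (q + 2) q (Uq M (q + 2) q) G)
    (hQc : (Q \ coloops M G).card = ρ) : M.Indep (Q : Set α) := by
  have hKQ : coloops M G ⊆ Q := coloops_subset_of_mem_shadowAt hQ
  have hr : M.eRk (Q : Set α) = ((q + 1 : ℕ) : ℕ∞) :=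
    eRk_eq_of_mem_Yq_diag (mem_shadow.1 (mem_shadowAt.1 hQ).1).1
  have hcard : Q.card = q + 1 := by
    rw [← Finset.card_sdiff_add_card_eq_card hKQ, hQc, ← kColoops_eq_card_coloops]; omega
  apply indep_of_rkN_eq_card
  rw [hcard]
  have := eRk_eq_rkN (M := M) Q
  rw [hr] at this
  exact_mod_cast this.symm

/-- `w ∈ Q ∖ K` is missed by its own face: `w ∈ G ∖ cl (Q ∖ w)`. -/
theorem mem_sdiff_clF_erase_self {q ρ : ℕ} {G : Finset α}
    (hk : kColoops M G + ρ = q + 1) {Q : Finset α} (hQ : Q ∈ shadowAt M (q + 2) q (Uq M (q + 2) q) G)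
    (hQc : (Q \ coloops M G).card = ρ) {w : α} (hw : w ∈ Q) : w ∈ G \ clF M (Q.erase w) := by
  have hI := indep_of_mem_shadowAt_card hk hQ hQc
  have hQG : Q ⊆ G := subset_G_of_mem_shadowAt hQ
  rw [Finset.mem_sdiff]
  refine ⟨hQG hw, ?_⟩
  intro hcl
  have h1 := hI.notMem_closure_sdiff_of_mem (Finset.mem_coe.2 hw)
  apply h1
  rw [← Finset.coe_singleton, ← Finset.coe_sdiff, Finset.sdiff_singleton_eq_erase]
  exact mem_clF_iff.1 hcl

/-- **A face misses at least two points**: `m_w ≥ 2` for `w ∈ Q ∖ K` (`w` is not a coloop of `M|G`). -/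
theorem two_le_card_face {q ρ : ℕ} {G : Finset α}
    (hk : kColoops M G + ρ = q + 1) {Q : Finset α} (hQ : Q ∈ shadowAt M (q + 2) q (Uq M (q + 2) q) G)
    (hQc : (Q \ coloops M G).card = ρ) {w : α} (hw : w ∈ Q \ coloops M G) :
    2 ≤ (G \ clF M (Q.erase w)).card := by
  have hwQ : w ∈ Q := (Finset.mem_sdiff.1 hw).1
  have hwK : w ∉ coloops M G := (Finset.mem_sdiff.1 hw).2
  have hself := mem_sdiff_clF_erase_self hk hQ hQc hwQ
  have hQG : Q ⊆ G := subset_G_of_mem_shadowAt hQ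
  by_contra hlt
  push Not at hlt
  have hone : (G \ clF M (Q.erase w)).card ≤ 1 := by omega
  have hsing : ∀ x ∈ G \ clF M (Q.erase w), x = w :=
    fun x hx => Finset.card_le_one.1 hone x hx w hself
  apply hwK
  rw [mem_coloops]
  refine ⟨hQG hwQ, ?_⟩
  have hsub : G.erase w ⊆ clF M (Q.erase w) := by
    intro x hx
    rw [Finset.mem_erase] at hx
    by_contra hxc
    exact hx.1 (hsing x (Finset.mem_sdiff.2 ⟨hx.2, hxc⟩))
  have h2 : clF M (G.erase w) ⊆ clF M (Q.erase w) := by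
    have := clF_mono (M := M) hsub
    rwa [clF_clF] at this
  intro hw'
  exact (Finset.mem_sdiff.1 hself).2 (h2 hw')

/-- **A face misses at most `|G ∖ Q| + 1` points**: `G ∖ cl (Q ∖ w) ⊆ {w} ∪ (G ∖ Q)`. -/
theorem card_face_le {q : ℕ} {G : Finset α} (hG : G ∈ flatsQ M (q + 1)) {Q : Finset α}
    (hQ : Q ∈ shadowAt M (q + 2) q (Uq M (q + 2) q) G) {w : α} :
    (G \ clF M (Q.erase w)).card ≤ (G \ Q).card + 1 := by
  have hQG : Q ⊆ G := subset_G_of_mem_shadowAt hQ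
  have hGg : G ⊆ gr M := (mem_flatsQ.1 hG).1
  have hsub : G \ clF M (Q.erase w) ⊆ insert w (G \ Q) := by
    intro x hx
    rw [Finset.mem_sdiff] at hx
    rw [Finset.mem_insert, Finset.mem_sdiff]
    by_cases hxw : x = w
    · exact Or.inl hxw
    · right
      refine ⟨hx.1, fun hxQ => hx.2 ?_⟩
      exact subset_clF_of_subset_gr ((Finset.erase_subset w Q).trans hQG |>.trans hGg)
        (Finset.mem_erase.2 ⟨hxw, hxQ⟩)
  exact (Finset.card_le_card hsub).trans (Finset.card_insert_le _ _)

/-- **The support of an outside point has at least two elements**: for `y ∈ G ∖ Q`, at least two `w ∈ Q ∖ K`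
have `y ∉ cl (Q ∖ w)` (else `y` lies in `cl (K ∪ {w₀})`, impossible by the coloop rank split and simplicity). -/
theorem two_le_card_support {q ρ : ℕ} {G : Finset α} (hG : G ∈ flatsQ M (q + 1))
    (hk : kColoops M G + ρ = q + 1) (hs : ∀ e ∈ gr M, ∀ f ∈ gr M, e ≠ f → rkN M {e, f} = 2)
    (hl : ∀ e ∈ gr M, M.Indep {e}) {Q : Finset α} (hQ : Q ∈ shadowAt M (q + 2) q (Uq M (q + 2) q) G)
    (hQc : (Q \ coloops M G).card = ρ) {y : α} (hy : y ∈ G \ Q) :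
    2 ≤ ((Q \ coloops M G).filter (fun w => y ∉ clF M (Q.erase w))).card := by
  have hI := indep_of_mem_shadowAt_card hk hQ hQc
  have hQG : Q ⊆ G := subset_G_of_mem_shadowAt hQ
  have hGg : G ⊆ gr M := (mem_flatsQ.1 hG).1
  have hKQ : coloops M G ⊆ Q := coloops_subset_of_mem_shadowAt hQ
  have hclQ : clF M Q = G := (mem_shadowAt.1 hQ).2
  have hyG : y ∈ G := (Finset.mem_sdiff.1 hy).1
  have hyQ : y ∉ Q := (Finset.mem_sdiff.1 hy).2
  by_contra hlt
  push Not at hlt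
  set J := (Q \ coloops M G).filter (fun w => y ∈ clF M (Q.erase w)) with hJ
  have hJQ : J ⊆ Q := fun w hw => (Finset.mem_sdiff.1 (Finset.mem_filter.1 hw).1).1
  have hJK : ∀ w ∈ J, w ∉ coloops M G := fun w hw => (Finset.mem_sdiff.1 (Finset.mem_filter.1 hw).1).2
  -- the complement of J in Q ∖ K is the support, of size ≤ 1
  have hcompl : (Q \ coloops M G) \ J = (Q \ coloops M G).filter (fun w => y ∉ clF M (Q.erase w)) := by
    ext w
    simp only [hJ, Finset.mem_sdiff, Finset.mem_filter]
    tauto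
  have hsmall : ((Q \ coloops M G) \ J).card ≤ 1 := by rw [hcompl]; omega
  have hmem : y ∈ clF M (Q \ J) :=
    mem_clF_sdiff_of_forall_mem_clF_erase hI (by rw [hclQ]; exact hyG) J hJQ
      (fun b hb => (Finset.mem_filter.1 hb).2)
  -- rank split over the coloops: ρ(K ∪ X) = k + ρ(X)
  have hQJG : Q \ J ⊆ G := Finset.sdiff_subset.trans hQG
  have hKQJ : coloops M G ⊆ Q \ J := by
    intro x hx
    rw [Finset.mem_sdiff]
    exact ⟨hKQ hx, fun hxJ => hJK x hxJ hx⟩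
  have hyK : y ∉ coloops M G := fun h => hyQ (hKQ h)
  have hins : insert y (Q \ J) ⊆ G := Finset.insert_subset hyG hQJG
  have hKins : coloops M G ⊆ insert y (Q \ J) := hKQJ.trans (Finset.subset_insert _ _)
  have e1 := eRk_eq_kColoops_add_sdiff hGg hQJG hKQJ
  have e2 := eRk_eq_kColoops_add_sdiff hGg hins hKins
  have hrk : M.eRk ((insert y (Q \ J) : Finset α) : Set α) = M.eRk ((Q \ J : Finset α) : Set α) := by
    have h1 := rkN_insert_le_of_mem_clF (hQJG.trans hGg) hmem
    have h2 := rkN_mono (M := M) (Finset.subset_insert y (Q \ J))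
    rw [eRk_eq_rkN, eRk_eq_rkN]
    exact_mod_cast le_antisymm h1 h2
  have hX : (insert y (Q \ J)) \ coloops M G = insert y ((Q \ J) \ coloops M G) := by
    ext x
    simp only [Finset.mem_sdiff, Finset.mem_insert]
    constructor
    · rintro ⟨h | h, hx⟩
      · exact Or.inl h
      · exact Or.inr ⟨h, hx⟩
    · rintro (rfl | ⟨h, hx⟩)
      · exact ⟨Or.inl rfl, hyK⟩
      · exact ⟨Or.inr h, hx⟩
  have hX2 : (Q \ J) \ coloops M G = (Q \ coloops M G) \ J := by
    ext x; simp only [Finset.mem_sdiff]; tauto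
  rw [e1, e2, hX, hX2] at hrk
  have hrk' : M.eRk ((insert y ((Q \ coloops M G) \ J) : Finset α) : Set α) =
      M.eRk (((Q \ coloops M G) \ J : Finset α) : Set α) := by
    exact WithTop.add_left_cancel (ENat.coe_ne_top _) hrk
  -- the set (Q ∖ K) ∖ J has ≤ 1 element, so the rank of `insert y` is ≤ 1, so it has ≤ 1 element: contradiction
  have hle1 : M.eRk ((insert y ((Q \ coloops M G) \ J) : Finset α) : Set α) ≤ 1 := by
    rw [hrk']
    calc M.eRk (((Q \ coloops M G) \ J : Finset α) : Set α)
        ≤ (((Q \ coloops M G) \ J).card : ℕ∞) := by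
          rw [← Set.encard_coe_eq_coe_finsetCard]; exact M.eRk_le_encard _
      _ ≤ 1 := by exact_mod_cast hsmall
  have hsubg : insert y ((Q \ coloops M G) \ J) ⊆ gr M :=
    Finset.insert_subset (hGg hyG) ((Finset.sdiff_subset.trans Finset.sdiff_subset).trans (hQG.trans hGg))
  have hc1 := card_le_one_of_eRk_le_one_dqm1 hs hsubg hle1
  have hyni : y ∉ (Q \ coloops M G) \ J := fun h => hyQ (Finset.mem_sdiff.1 (Finset.mem_sdiff.1 h).1).1
  rw [Finset.card_insert_of_notMem hyni] at hc1
  have hemp : (Q \ coloops M G) \ J = ∅ := Finset.card_eq_zero.1 (by omega)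
  rw [hemp] at hrk'
  simp only [Finset.insert_empty, Finset.coe_empty, Matroid.eRk_empty] at hrk'
  have h1 : 1 ≤ M.eRk (({y} : Finset α) : Set α) :=
    one_le_eRk_of_nonempty hl (Finset.singleton_subset_iff.2 (hGg hyG)) (Finset.singleton_nonempty y)
  rw [hrk'] at h1
  exact absurd h1 (by decide)

/-- **THE FACE SUM**: `Σ_{w ∈ Q ∖ K} |G ∖ cl (Q ∖ w)| ≥ 2 |G ∖ K| − ρ` for every covering basis `Q`
(`K ⊆ Q`, `|Q ∖ K| = ρ`, `cl Q = G`) of a simple loopless matroid. -/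
theorem two_mul_card_le_sum_faces {q ρ : ℕ} {G : Finset α} (hG : G ∈ flatsQ M (q + 1))
    (hk : kColoops M G + ρ = q + 1) (hs : ∀ e ∈ gr M, ∀ f ∈ gr M, e ≠ f → rkN M {e, f} = 2)
    (hl : ∀ e ∈ gr M, M.Indep {e}) {Q : Finset α} (hQ : Q ∈ shadowAt M (q + 2) q (Uq M (q + 2) q) G)
    (hQc : (Q \ coloops M G).card = ρ) :
    2 * (G \ coloops M G).card ≤ ρ + ∑ w ∈ Q \ coloops M G, (G \ clF M (Q.erase w)).card := by
  have hQG : Q ⊆ G := subset_G_of_mem_shadowAt hQ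
  have hKQ : coloops M G ⊆ Q := coloops_subset_of_mem_shadowAt hQ
  set T := Q \ coloops M G with hT
  -- double counting: Σ_w |G ∖ cl (Q ∖ w)| = Σ_{y ∈ G} #{w ∈ T : y ∉ cl (Q ∖ w)}
  have hswap : ∑ w ∈ T, (G \ clF M (Q.erase w)).card =
      ∑ y ∈ G, (T.filter (fun w => y ∉ clF M (Q.erase w))).card := by
    have h1 : ∀ w ∈ T, (G \ clF M (Q.erase w)).card = ∑ y ∈ G, if y ∉ clF M (Q.erase w) then 1 else 0 := by
      intro w _
      rw [Finset.sdiff_eq_filter, Finset.card_filter]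
    have h2 : ∀ y ∈ G, (T.filter (fun w => y ∉ clF M (Q.erase w))).card =
        ∑ w ∈ T, if y ∉ clF M (Q.erase w) then 1 else 0 := by
      intro y _
      rw [Finset.card_filter]
    rw [Finset.sum_congr rfl h1, Finset.sum_congr rfl h2, Finset.sum_comm]
  rw [hswap]
  -- restrict the outer sum to T ∪ (G ∖ Q)
  have hTG : T ⊆ G := Finset.sdiff_subset.trans hQG
  have hdisj : Disjoint T (G \ Q) := by
    rw [Finset.disjoint_left]
    intro x hx hx'
    exact (Finset.mem_sdiff.1 hx').2 (Finset.mem_sdiff.1 hx).1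
  have hunion : T ∪ (G \ Q) ⊆ G := Finset.union_subset hTG Finset.sdiff_subset
  have hge : ∑ y ∈ T ∪ (G \ Q), (T.filter (fun w => y ∉ clF M (Q.erase w))).card ≤
      ∑ y ∈ G, (T.filter (fun w => y ∉ clF M (Q.erase w))).card :=
    Finset.sum_le_sum_of_subset_of_nonneg hunion (fun _ _ _ => Nat.zero_le _)
  rw [Finset.sum_union hdisj] at hge
  -- each y ∈ T contributes ≥ 1, each y ∈ G ∖ Q contributes ≥ 2
  have hA : T.card ≤ ∑ y ∈ T, (T.filter (fun w => y ∉ clF M (Q.erase w))).card := by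
    calc T.card = ∑ _y ∈ T, 1 := by rw [Finset.sum_const, smul_eq_mul, mul_one]
      _ ≤ ∑ y ∈ T, (T.filter (fun w => y ∉ clF M (Q.erase w))).card := by
          apply Finset.sum_le_sum
          intro y hy
          apply Finset.card_pos.2
          refine ⟨y, Finset.mem_filter.2 ⟨hy, ?_⟩⟩
          exact (Finset.mem_sdiff.1 (mem_sdiff_clF_erase_self hk hQ hQc (Finset.mem_sdiff.1 hy).1)).2
  have hB : 2 * (G \ Q).card ≤ ∑ y ∈ G \ Q, (T.filter (fun w => y ∉ clF M (Q.erase w))).card := by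
    calc 2 * (G \ Q).card = ∑ _y ∈ G \ Q, 2 := by rw [Finset.sum_const, smul_eq_mul, mul_comm]
      _ ≤ ∑ y ∈ G \ Q, (T.filter (fun w => y ∉ clF M (Q.erase w))).card := by
          apply Finset.sum_le_sum
          intro y hy
          exact two_le_card_support hG hk hs hl hQ hQc hy
  -- |G ∖ Q| = |G ∖ K| − ρ
  have hcard : (G \ Q).card + ρ = (G \ coloops M G).card := by
    have h1 : (G \ coloops M G) = (G \ Q) ∪ T := by
      ext x
      simp only [Finset.mem_union, Finset.mem_sdiff, hT]
      constructor
      · rintro ⟨hxG, hxK⟩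
        by_cases hxQ : x ∈ Q
        · exact Or.inr ⟨hxQ, hxK⟩
        · exact Or.inl ⟨hxG, hxQ⟩
      · rintro (⟨hxG, hxQ⟩ | ⟨hxQ, hxK⟩)
        · exact ⟨hxG, fun h => hxQ (hKQ h)⟩
        · exact ⟨hQG hxQ, hxK⟩
    rw [h1, Finset.card_union_of_disjoint hdisj.symm, hQc]
  rw [← hQc]
  omega

end PercRepro.Shadow
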